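import Literature.FieldTheory.FunctionField.RationalClosedPointTraceFormula
import Literature.FieldTheory.FunctionField.RationalDegreeOnePointFibres
import HarnessLib

/-!
# The trace formula for residues over the places of DEGREE ONE of `P¹_t` (`t = c` and `t = ∞`), fibres counted over
# the closed points of `P¹_u` and `u = ∞`, WITHOUT splitting hypotheses (Chevalley VI §2 Thm 1 + Thm 3, §6 Thm 12)

Topic `Literature/FieldTheory/FunctionField`; namespace `Literature.FieldTheory.FunctionField`.  Lane
`lit-hodgefound` (Track 2 foundations library), seat p01 gen 24, row g24-#11.  THEOREMS ONLY (no definition, no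
named fact, no instance, no notation; D-0014/D-0026, net Literature debt 0).  Sequel BY IMPORT of g24-#9
(`RationalClosedPointTraceFormula`: the per-point identity `ratFuncTraceResidueAt_ratFuncSubst_mul_derivation` and
the formula at the closed points of degree `≥ 2`), g24-#10 (`RationalDegreeOnePointFibres`: the fibres over `t = c`
and `t = ∞`, `num_sub_C`, `sum_natDegree_mul_multiplicity_num_sub_C_add`), g24-#4 (the pole case
`ratFuncResidueAtPlace_ratFuncSubst_mul_derivation_of_pole_eq_ratFuncOrderAtPlace_mul`), g22-#6
(`ratFuncResidueAtInfty_ratFuncSubst_mul_derivation_of_finite_eq_order_mul` / `_of_pole_eq_order_mul`: the place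
`u = ∞`), g23-#1 (`ratFuncTraceResidueAt_X_sub_C`, `finrank_adjoinRoot`) — REUSED, nothing restated.  g22-#6
`sum_ratFuncResidueAt_ratFuncSubst_div_mul_derivation` needs the fibre `P − cQ` to SPLIT in `K` and to avoid the
poles; here `K` is arbitrary and the fibre is summed over closed points of any degree (with their traces) plus
`u = ∞` when it lies over the point.  With g24-#9 this is VI §2 Thm 1 for `Ω = Cosp ω` at EVERY place of `P¹_t`.

## Sources, VERBATIM

C. Chevalley, *Introduction to the Theory of Algebraic Functions of One Variable* [ChevalleyAlgebraicFunctions1951]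
(galaxy `panama:249279901859876`), Ch. VI §2 Thm 1 (PDF p0145): «`res_𝔭 Sp_{S/R} Ω = Σ_{i=1}^h Sp_{Σ_s(𝔓_i)/Σ_s(𝔭)}
res_{𝔓_i} Ω`»; Thm 3 (PDF p0149): «`res_𝔓 Cosp_{R/S} ω = e res_𝔭 ω`»; Ch. VI §6 Thm 12 (PDF p0170): «`Sp_{S/R}(z
Cosp_{R/S} ω) = (Sp_{S/R} z) ω`» (`z = 1`: `[S : R] res_𝔭 ω = Σ_i Sp res_{𝔓_i} Cosp ω`).  H. Stichtenoth
[Stichtenoth2009], Thm. 3.1.11 (PDF p0070, `Σ e_i f_i = [F′ : F]`), Prop. 1.2.1 (the places `P_{x−c}`, `P_∞` of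
`K(x)`, of degree one).

## What is formalised (`w ∈ K(u)` non-constant, `t = w(u)`, `deg w = max(deg num w, deg denom w) = [K(u) : K(t)]`;
## the lane's `(D, hD)`; `Cosp(f dt) = (f∘w)·(D w) du`; all closed points in the fibres assumed separable)

* §1 over `𝔭_c : t = c` (`c ∈ K`, `res_{𝔭_c} = Res_c`): `sum_ratFuncTraceResidueAt_ratFuncSubst_mul_derivation_sub_C`:
  `Σ_{(P)|𝔭_c} Sp_{F_P/K} res_P Cosp(f dt) = (deg w − v_∞(w − c)⁺) · Res_c(f dt)`; hence
  **`…_sub_C_add_residueAtInfty`** (`u = ∞` over `𝔭_c`, i.e. `v_∞(w − c) > 0`):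
  `Σ_{(P)|𝔭_c} Sp res_P Cosp(f dt) + Res_{u=∞} Cosp(f dt) = deg w · Res_c(f dt)`, and **`…_sub_C_of_order_nonpos`**
  (`u = ∞` not over `𝔭_c`): `Σ_{(P)|𝔭_c} Sp res_P Cosp(f dt) = deg w · Res_c(f dt)`.
* §2 over `𝔭_∞ : t = ∞` (`res = Res_∞`): `ratFuncTraceResidueAt_ratFuncSubst_mul_derivation_of_dvd_denom` (one pole
  `(P)`: `Sp res_P Cosp(f dt) = mult_P(denom w)·deg P · Res_∞(f dt)`), `sum_ratFuncTraceResidueAt_ratFuncSubst_mul_derivation_denom`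
  (`Σ_{P ∣ denom w} = deg denom w · Res_∞(f dt)`); **`…_denom_add_residueAtInfty`** (`deg num > deg denom`):
  `Σ_{P ∣ denom} Sp res_P Cosp + Res_{u=∞} Cosp = deg w · Res_∞(f dt)`; **`…_denom_of_natDegree_le`** (`deg num ≤ deg denom`):
  `Σ_{P ∣ denom} Sp res_P Cosp = deg w · Res_∞(f dt)`.

## Honest scope

`K(u)/K(t)` only; every closed point `(P)` of the fibre is assumed separable (residues at closed points are read at
the rational place `θ` of `F_P(u)`, g23-#1); `z = 1` in Thm 12.
-/

noncomputable section

open Polynomial HahnSeries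

namespace Literature.FieldTheory.FunctionField

variable {K : Type*} [Field K]

/-- `(t − c) ∘ w = w − c`. [folklore] -/
private theorem aeval_X_sub_C'' (w : RatFunc K) (c : K) : aeval w (X - Polynomial.C c) = w - RatFunc.C c := by
  rw [map_sub, aeval_X, aeval_C, RatFunc.algebraMap_eq_C]

/-- `E_∞ w − c = E_∞(w − c)`, non-zero for a non-constant `w`. [folklore] -/
private theorem ratFuncExpansionAtInfty_sub_C' {w : RatFunc K} (hw : ¬ ∃ c, w = RatFunc.C c) (c : K) :
    ratFuncExpansionAtInfty w - HahnSeries.C c = ratFuncExpansionAtInfty (w - RatFunc.C c) ∧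
      ratFuncExpansionAtInfty (w - RatFunc.C c) ≠ 0 :=
  ⟨by rw [map_sub, ratFuncExpansionAtInfty_C], (_root_.map_ne_zero _).mpr fun h => hw ⟨c, sub_eq_zero.mp h⟩⟩

section

variable {w : RatFunc K} (hw : ¬ ∃ c, w = RatFunc.C c) (D : Derivation K (RatFunc K) (RatFunc K))
  (hD : ∀ A : K[X], D (algebraMap K[X] (RatFunc K) A) = algebraMap K[X] (RatFunc K) (derivative A))
include hD

/-! ### §1. Over the rational point `𝔭_c : t = c` -/

/-- **The closed points over `𝔭_c`**: `Σ_{(P) | 𝔭_c} Sp_{F_P/K} res_P((f∘w)·Dw du) = (deg w − v_∞(w − c)⁺) · Res_c(f dt)`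
— each `(P)` contributes `e·f = mult_P(num(w − c))·deg P` copies of `Res_c(f dt)` (g24-#9 with `𝔭 = (t − c)`), and
`Σ e·f` over the closed points is `deg w − v_∞(w − c)⁺` (g24-#10). [cite: ChevalleyAlgebraicFunctions1951, Ch. VI §2 Thm 1, Thm 3][cite: Stichtenoth2009, Thm. 3.1.11] -/
theorem sum_ratFuncTraceResidueAt_ratFuncSubst_mul_derivation_sub_C [DecidableEq K] (c : K)
    (hsep : ∀ P ∈ (UniqueFactorizationMonoid.normalizedFactors (w - RatFunc.C c).num).toFinset, P.Separable)
    (f : RatFunc K) :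
    ∑ P ∈ (UniqueFactorizationMonoid.normalizedFactors (w - RatFunc.C c).num).toFinset,
        ratFuncTraceResidueAt P (ratFuncSubst w hw f * D w) =
      ((max w.num.natDegree w.denom.natDegree - (ratFuncExpansionAtInfty (w - RatFunc.C c)).order.toNat : ℕ) : K) *
        ratFuncResidueAt c f := by
  haveI : Fact (Irreducible (X - Polynomial.C c)) := ⟨irreducible_X_sub_C c⟩
  have hS : (aeval w (X - Polynomial.C c)).num = (w - RatFunc.C c).num := by rw [aeval_X_sub_C'']
  have hsum := sum_natDegree_mul_multiplicity_num_sub_C_add hw c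
  rw [← Nat.eq_sub_of_add_eq hsum, Nat.cast_sum, Finset.sum_mul]
  refine Finset.sum_congr rfl fun P hP => ?_
  have hP' := Multiset.mem_toFinset.mp hP
  haveI : Fact (Irreducible P) := ⟨UniqueFactorizationMonoid.irreducible_of_normalized_factor P hP'⟩
  have hPQ : P ∣ (aeval w (X - Polynomial.C c)).num := by
    rw [hS]
    exact UniqueFactorizationMonoid.dvd_of_mem_normalizedFactors hP'
  rw [ratFuncTraceResidueAt_ratFuncSubst_mul_derivation hw D hD (X - Polynomial.C c) (separable_X_sub_C) P
    (hsep P hP) hPQ f, ratFuncTraceResidueAt_X_sub_C, natDegree_X_sub_C, Nat.div_one, hS, mul_comm (multiplicity _ _)]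

/-- **VI §2 Thm 1 at `𝔭_c` when `u = ∞` lies over it** (`v_∞(w − c) > 0`, `e(∞|𝔭_c) = v_∞(w − c)`, `f = 1`):
`Σ_{(P) | 𝔭_c} Sp_{F_P/K} res_P Cosp(f dt) + Res_{u=∞} Cosp(f dt) = deg w · Res_c(f dt)`.
[cite: ChevalleyAlgebraicFunctions1951, Ch. VI §2 Thm 1, Thm 3; Ch. VI §6 Thm 12][cite: Stichtenoth2009, Thm. 3.1.11] -/
theorem sum_ratFuncTraceResidueAt_ratFuncSubst_mul_derivation_sub_C_add_residueAtInfty [DecidableEq K] (c : K)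
    (hsep : ∀ P ∈ (UniqueFactorizationMonoid.normalizedFactors (w - RatFunc.C c).num).toFinset, P.Separable)
    (hpos : 0 < (ratFuncExpansionAtInfty (w - RatFunc.C c)).order) (f : RatFunc K) :
    ∑ P ∈ (UniqueFactorizationMonoid.normalizedFactors (w - RatFunc.C c).num).toFinset,
        ratFuncTraceResidueAt P (ratFuncSubst w hw f * D w) +
      ratFuncResidueAtInfty (ratFuncSubst w hw f * D w) =
        ((max w.num.natDegree w.denom.natDegree : ℕ) : K) * ratFuncResidueAt c f := by
  obtain ⟨hE, hne⟩ := ratFuncExpansionAtInfty_sub_C' hw c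
  have hu : 0 < (ratFuncExpansionAtInfty w - HahnSeries.C c).orderTop := by
    rw [hE, ← order_eq_orderTop_of_ne_zero hne]
    exact WithTop.coe_pos.mpr hpos
  have hle : (ratFuncExpansionAtInfty (w - RatFunc.C c)).order.toNat ≤ max w.num.natDegree w.denom.natDegree := by
    have h := sum_natDegree_mul_multiplicity_num_sub_C_add hw c
    omega
  have hcast : (((ratFuncExpansionAtInfty (w - RatFunc.C c)).order : ℤ) : K) =
      (((ratFuncExpansionAtInfty (w - RatFunc.C c)).order.toNat : ℕ) : K) := by
    rw [← Int.cast_natCast, Int.toNat_of_nonneg hpos.le]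
  rw [sum_ratFuncTraceResidueAt_ratFuncSubst_mul_derivation_sub_C hw D hD c hsep f,
    ratFuncResidueAtInfty_ratFuncSubst_mul_derivation_of_finite_eq_order_mul w hw D hD hu f, hE, hcast,
    Nat.cast_sub hle]
  ring

/-- **VI §2 Thm 1 at `𝔭_c` when `u = ∞` does not lie over it** (`v_∞(w − c) ≤ 0`):
`Σ_{(P) | 𝔭_c} Sp_{F_P/K} res_P Cosp(f dt) = deg w · Res_c(f dt)`.
[cite: ChevalleyAlgebraicFunctions1951, Ch. VI §2 Thm 1, Thm 3; Ch. VI §6 Thm 12][cite: Stichtenoth2009, Thm. 3.1.11] -/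
theorem sum_ratFuncTraceResidueAt_ratFuncSubst_mul_derivation_sub_C_of_order_nonpos [DecidableEq K] (c : K)
    (hsep : ∀ P ∈ (UniqueFactorizationMonoid.normalizedFactors (w - RatFunc.C c).num).toFinset, P.Separable)
    (hnonpos : (ratFuncExpansionAtInfty (w - RatFunc.C c)).order ≤ 0) (f : RatFunc K) :
    ∑ P ∈ (UniqueFactorizationMonoid.normalizedFactors (w - RatFunc.C c).num).toFinset,
        ratFuncTraceResidueAt P (ratFuncSubst w hw f * D w) =
      ((max w.num.natDegree w.denom.natDegree : ℕ) : K) * ratFuncResidueAt c f := by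
  rw [sum_ratFuncTraceResidueAt_ratFuncSubst_mul_derivation_sub_C hw D hD c hsep f, Int.toNat_eq_zero.mpr hnonpos,
    Nat.sub_zero]

/-! ### §2. Over `𝔭_∞ : t = ∞` (the poles of `w`) -/

/-- **One pole `(P)` of `w`** (`P ∣ denom w`, `P` separable): `Sp_{F_P/K} res_P((f∘w)·Dw du) = mult_P(denom w) · deg P ·
Res_∞(f dt)` (`e = mult_P(denom w) = ν_P(1/w)`, `f = deg P`; VI §2 Thm 3 at a pole, g24-#4, traced down).
[cite: ChevalleyAlgebraicFunctions1951, Ch. VI §2 Thm 3, Thm 1 (proof)][cite: Stichtenoth2009, Def. 3.1.5, Prop. 1.2.1] -/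
theorem ratFuncTraceResidueAt_ratFuncSubst_mul_derivation_of_dvd_denom (P : K[X]) [Fact (Irreducible P)]
    (hPsep : P.Separable) (hPw : P ∣ w.denom) (f : RatFunc K) :
    ratFuncTraceResidueAt P (ratFuncSubst w hw f * D w) =
      ((multiplicity P w.denom * P.natDegree : ℕ) : K) * ratFuncResidueAtInfty f := by
  have hP : Irreducible P := Fact.out
  have hw0 : w ≠ 0 := fun h => hw ⟨0, by rw [h, map_zero]⟩
  have hν : ratFuncOrderAtPlace P w⁻¹ = multiplicity P w.denom := by
    rw [ratFuncOrderAtPlace_inv hP w hw0, ratFuncOrderAtPlace_eq_neg_multiplicity_denom hP hPw, neg_neg]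
  rw [ratFuncTraceResidueAt_eq,
    ratFuncResidueAtPlace_ratFuncSubst_mul_derivation_of_pole_eq_ratFuncOrderAtPlace_mul P w hw hPw D hD hPsep f, hν,
    Int.cast_natCast, ← map_natCast (algebraMap K (AdjoinRoot P)), ← map_mul, Algebra.trace_algebraMap,
    finrank_adjoinRoot, nsmul_eq_mul, ← mul_assoc, ← Nat.cast_mul, mul_comm P.natDegree]

/-- **The poles `(P)`, `P ∣ denom w`, together**: `Σ_{P ∣ denom w} Sp_{F_P/K} res_P((f∘w)·Dw du) = deg(denom w) ·
Res_∞(f dt)`. [cite: ChevalleyAlgebraicFunctions1951, Ch. VI §2 Thm 1, Thm 3][cite: Stichtenoth2009, Thm. 3.1.11, Thm. 1.4.11] -/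
theorem sum_ratFuncTraceResidueAt_ratFuncSubst_mul_derivation_denom [DecidableEq K]
    (hsep : ∀ P ∈ (UniqueFactorizationMonoid.normalizedFactors w.denom).toFinset, P.Separable) (f : RatFunc K) :
    ∑ P ∈ (UniqueFactorizationMonoid.normalizedFactors w.denom).toFinset,
        ratFuncTraceResidueAt P (ratFuncSubst w hw f * D w) =
      (w.denom.natDegree : K) * ratFuncResidueAtInfty f := by
  rw [← sum_natDegree_mul_multiplicity_eq_natDegree w.denom w.denom_ne_zero, Nat.cast_sum, Finset.sum_mul]
  refine Finset.sum_congr rfl fun P hP => ?_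
  have hP' := Multiset.mem_toFinset.mp hP
  haveI : Fact (Irreducible P) := ⟨UniqueFactorizationMonoid.irreducible_of_normalized_factor P hP'⟩
  rw [ratFuncTraceResidueAt_ratFuncSubst_mul_derivation_of_dvd_denom hw D hD P (hsep P hP)
    (UniqueFactorizationMonoid.dvd_of_mem_normalizedFactors hP') f, mul_comm (multiplicity _ _)]

/-- **VI §2 Thm 1 at `𝔭_∞` when `u = ∞` is a pole of `w`** (`deg num w > deg denom w`, `e(∞|𝔭_∞) = deg num − deg denom`):
`Σ_{P ∣ denom w} Sp_{F_P/K} res_P Cosp(f dt) + Res_{u=∞} Cosp(f dt) = deg w · Res_∞(f dt)`.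
[cite: ChevalleyAlgebraicFunctions1951, Ch. VI §2 Thm 1, Thm 3; Ch. VI §6 Thm 12][cite: Stichtenoth2009, Thm. 3.1.11] -/
theorem sum_ratFuncTraceResidueAt_ratFuncSubst_mul_derivation_denom_add_residueAtInfty [DecidableEq K]
    (hsep : ∀ P ∈ (UniqueFactorizationMonoid.normalizedFactors w.denom).toFinset, P.Separable)
    (hlt : w.denom.natDegree < w.num.natDegree) (f : RatFunc K) :
    ∑ P ∈ (UniqueFactorizationMonoid.normalizedFactors w.denom).toFinset,
        ratFuncTraceResidueAt P (ratFuncSubst w hw f * D w) +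
      ratFuncResidueAtInfty (ratFuncSubst w hw f * D w) =
        ((max w.num.natDegree w.denom.natDegree : ℕ) : K) * ratFuncResidueAtInfty f := by
  have hw0 : w ≠ 0 := fun h => hw ⟨0, by rw [h, map_zero]⟩
  have hne : ratFuncExpansionAtInfty w⁻¹ ≠ 0 := (_root_.map_ne_zero _).mpr (inv_ne_zero hw0)
  have hord : (ratFuncExpansionAtInfty w⁻¹).order = (w.num.natDegree : ℤ) - w.denom.natDegree := by
    rw [order_ratFuncExpansionAtInfty _ (inv_ne_zero hw0), RatFunc.intDegree_inv, neg_neg, RatFunc.intDegree]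
  have hu : 0 < (ratFuncExpansionAtInfty w⁻¹).orderTop := by
    rw [← order_eq_orderTop_of_ne_zero hne, hord]
    exact WithTop.coe_pos.mpr (by omega)
  rw [sum_ratFuncTraceResidueAt_ratFuncSubst_mul_derivation_denom hw D hD hsep f,
    ratFuncResidueAtInfty_ratFuncSubst_mul_derivation_of_pole_eq_order_mul w hw D hD hu f, hord, max_eq_left hlt.le,
    Int.cast_sub, Int.cast_natCast, Int.cast_natCast]
  ring

/-- **VI §2 Thm 1 at `𝔭_∞` when `u = ∞` is not a pole** (`deg num w ≤ deg denom w`, `deg w = deg denom w`):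
`Σ_{P ∣ denom w} Sp_{F_P/K} res_P Cosp(f dt) = deg w · Res_∞(f dt)`.
[cite: ChevalleyAlgebraicFunctions1951, Ch. VI §2 Thm 1, Thm 3; Ch. VI §6 Thm 12][cite: Stichtenoth2009, Thm. 3.1.11] -/
theorem sum_ratFuncTraceResidueAt_ratFuncSubst_mul_derivation_denom_of_natDegree_le [DecidableEq K]
    (hsep : ∀ P ∈ (UniqueFactorizationMonoid.normalizedFactors w.denom).toFinset, P.Separable)
    (hle : w.num.natDegree ≤ w.denom.natDegree) (f : RatFunc K) :
    ∑ P ∈ (UniqueFactorizationMonoid.normalizedFactors w.denom).toFinset,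
        ratFuncTraceResidueAt P (ratFuncSubst w hw f * D w) =
      ((max w.num.natDegree w.denom.natDegree : ℕ) : K) * ratFuncResidueAtInfty f := by
  rw [sum_ratFuncTraceResidueAt_ratFuncSubst_mul_derivation_denom hw D hD hsep f, max_eq_right hle]

end

end Literature.FieldTheory.FunctionField
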